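import Summits.HodgeConjecture.HodgeConjecture.Theses.VHCAbelianSchemesRoad
import Summits.HodgeConjecture.HodgeConjecture.Theorems.VHCAbelianSchemesRoadRegimeAdditive
import HarnessLib

/-!
# BC3 skeleton v3.4.0a (COARSE, by name) for the ADDITIVE deciding crux `SemiregularSheafRepresentativesTwPrimeAtDiagAdd`
# (route `VHCAbelianSchemesRoad`, rev 23; director-hodge g11 RULING R11.3 (3); LEAD 160 = planner-pub-hodge-ring2-typer1-g158-0)

research route conditional on HC_CM; not a corollary; Q11.4-sentence-2 already refuted in dim ≥ 3.

THE CUT (R11.3 (3), by name): first cell `(4,2)` = ONE carrier, UNCHANGED IN KIND (the single-datum regime `LefAtExceptionalRegimeAt` at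
`(4,2)`, which gives the additive cell by `lefAtExceptionalRegimeAtAdd_of_lefAtExceptionalRegimeAt`, k = 1) · the `(6,3)` cell in ADDITIVE
form (v3.4.0: ONE coarse stub `LefAtExceptionalRegimeAtAdd (tw C AdmTw′) 6 3`; v3.4.1 re-cuts it BY NAME into «SPAN at the pinned
secant–quotient anchors (replacing G3′) · L1″ PER MOVER · 2b residual» as soon as the additive cells-by-name sugar
(`LefAtExceptionalRegimeAtAddUnder`, `AnchoredSpanAt`, the served ∕ residual split) lands — ring2-b03x g6 SPAN CHECK (a) names the fibres
and pins first) · the TAIL `(2m, m)`, `m ≥ 4`, additive. The composition `SemiregularSheafRepresentativesTwPrimeAtDiagAdd_of` concludes the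
ROUTE DECL BY NAME; `sorryAx` reaches it only through `stub_*`. The STRONGER aside-parent 20707 keeps skeleton v3.3 (ba3c7cae8f05833c) as the
record of the single-datum cut (stubs 1′, 2a‴, 2b‴, 3′); every single-datum stub implies the corresponding additive stub (single ⟹ additive).
Nothing here is claimed: the stubs are `sorry`, the door binder 20706 and `HC_CM` are untouched, `HC_AV` ∕ `HC` are not asserted.
-/

open Literature.AlgebraicGeometry.HodgeTheory (ChernCharacterBetti)
open Summit.HodgeConjecture.HodgeConjecture.Ring2.SemiregularRepresentatives (LefAtExceptionalRegimeAt LefAtExceptionalRegimeAtAdd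
  lefAtExceptionalRegimeAtAdd_of_lefAtExceptionalRegimeAt)

namespace Summit.HodgeConjecture.HodgeConjecture.Cruxes.SemiregularSheafRepresentativesTwPrimeAtDiagAdd.Birth

set_option linter.dupNamespace false

/-- STUB 1′ (size XL, research; MECHANISM cell, ONE carrier — unchanged in kind from v3.3): regime 2 (single datum) over the PRIMED twisted
door at `(4, 2)` — abelian fourfold pencils, codimension 2. -/
theorem stub_firstCell_fourfoldMiddleTwPrime : ∀ C : ChernCharacterBetti,
    LefAtExceptionalRegimeAt (Literature.AlgebraicGeometry.HodgeTheory.twistedReflexiveClass C (fun n X₀ I E => Summit.Ventures.HSemireg.gluableSigmaAdmissible n X₀ I E ∨ Literature.AlgebraicGeometry.HodgeTheory.bfSingleAdmissible' n X₀ I E)) 4 2 := by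
  sorry

/-- STUB 2⁺ (size XL; COARSE at v3.4.0 = the PROPOSED BC5 PLAN-ONLY RUNG-DESIGNATE; to be RE-CUT at v3.4.1 into SPAN-at-the-pinned-anchors ·
L1″-per-mover · 2b-residual): regime 2 in ADDITIVE (span) form over the PRIMED twisted door at `(6, 3)` — abelian sixfold pencils,
codimension 3: finitely many `AdmTw′`-admissible twisted data at fibres of the pencil whose carried classes span the `W`-direction modulo
Lefschetz. Print contact: Markman arXiv:2502.03415 Thm 1.4.1 ∕ Thm 1.5.1 (ONE σ-admissible carrier `γ₀` at each pinned split-Weil anchor,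
unrefereed); the second direction per pencil (e.g. the T1 push-forward mover carrying `[u⁶]·γ₀`, evidence #35 ∕ #51 on item 20707) owes L1″. -/
theorem stub_additiveCell_sixfoldMiddleTwPrime : ∀ C : ChernCharacterBetti,
    LefAtExceptionalRegimeAtAdd (Literature.AlgebraicGeometry.HodgeTheory.twistedReflexiveClass C (fun n X₀ I E => Summit.Ventures.HSemireg.gluableSigmaAdmissible n X₀ I E ∨ Literature.AlgebraicGeometry.HodgeTheory.bfSingleAdmissible' n X₀ I E)) 6 3 := by
  sorry

/-- STUB 3⁺ (size XL, research; the TAIL, additive): regime 2 in additive form over the PRIMED twisted door at every diagonal cell `(2m, m)`,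
`m ≥ 4` — no print contact. -/
theorem stub_diagonalTailTwPrimeAdd : ∀ (C : ChernCharacterBetti) (m : ℕ), 4 ≤ m →
    LefAtExceptionalRegimeAtAdd (Literature.AlgebraicGeometry.HodgeTheory.twistedReflexiveClass C (fun n X₀ I E => Summit.Ventures.HSemireg.gluableSigmaAdmissible n X₀ I E ∨ Literature.AlgebraicGeometry.HodgeTheory.bfSingleAdmissible' n X₀ I E)) (2 * m) m := by
  sorry

/-- **BC3 composition, hypothesis form (additive)** — the three cell statements give the ADDITIVE crux statement spelled out (case split on
`m`; the `(4,2)` cell enters through single ⟹ additive). -/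
theorem twPrimeAtDiagAdd_of_cells
    (h₁ : ∀ C : ChernCharacterBetti,
      LefAtExceptionalRegimeAt (Literature.AlgebraicGeometry.HodgeTheory.twistedReflexiveClass C (fun n X₀ I E => Summit.Ventures.HSemireg.gluableSigmaAdmissible n X₀ I E ∨ Literature.AlgebraicGeometry.HodgeTheory.bfSingleAdmissible' n X₀ I E)) 4 2)
    (h₂ : ∀ C : ChernCharacterBetti,
      LefAtExceptionalRegimeAtAdd (Literature.AlgebraicGeometry.HodgeTheory.twistedReflexiveClass C (fun n X₀ I E => Summit.Ventures.HSemireg.gluableSigmaAdmissible n X₀ I E ∨ Literature.AlgebraicGeometry.HodgeTheory.bfSingleAdmissible' n X₀ I E)) 6 3)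
    (h₃ : ∀ (C : ChernCharacterBetti) (m : ℕ), 4 ≤ m →
      LefAtExceptionalRegimeAtAdd (Literature.AlgebraicGeometry.HodgeTheory.twistedReflexiveClass C (fun n X₀ I E => Summit.Ventures.HSemireg.gluableSigmaAdmissible n X₀ I E ∨ Literature.AlgebraicGeometry.HodgeTheory.bfSingleAdmissible' n X₀ I E)) (2 * m) m) :
    ∀ (C : ChernCharacterBetti) (m : ℕ), 2 ≤ m →
      LefAtExceptionalRegimeAtAdd (Literature.AlgebraicGeometry.HodgeTheory.twistedReflexiveClass C (fun n X₀ I E => Summit.Ventures.HSemireg.gluableSigmaAdmissible n X₀ I E ∨ Literature.AlgebraicGeometry.HodgeTheory.bfSingleAdmissible' n X₀ I E)) (2 * m) m := by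
  intro C m hm
  rcases Nat.lt_or_ge m 4 with hlt | hge
  · interval_cases m
    · exact lefAtExceptionalRegimeAtAdd_of_lefAtExceptionalRegimeAt (h₁ C)
    · exact h₂ C
  · exact h₃ C m hge

/-- **BC3 composition** — concludes the ROUTE DECL `SemiregularSheafRepresentativesTwPrimeAtDiagAdd` BY NAME from the three DECLARED stubs;
no hypothesis; `sorryAx` reaches it only through `stub_*`. -/
theorem SemiregularSheafRepresentativesTwPrimeAtDiagAdd_of :
    Summit.HodgeConjecture.HodgeConjecture.Theses.VHCAbelianSchemesRoad.SemiregularSheafRepresentativesTwPrimeAtDiagAdd :=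
  twPrimeAtDiagAdd_of_cells stub_firstCell_fourfoldMiddleTwPrime stub_additiveCell_sixfoldMiddleTwPrime stub_diagonalTailTwPrimeAdd

/- PARENT EDGE (not restated here, so that the ONLY theorem of this file concluding the route decl is `…_of` above): item 20707's
single-datum crux implies this additive crux by the LANDED `Summit.HodgeConjecture.HodgeConjecture.Ring2.SemiregularRepresentatives.
exceptionalRegimeAtAdd_admTw'_diagonal_of_exceptionalRegimeAt` (p578828), pointwise `lefAtExceptionalRegimeAtAdd_of_lefAtExceptionalRegimeAt` (p577976). -/

#print axioms twPrimeAtDiagAdd_of_cells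
#print axioms SemiregularSheafRepresentativesTwPrimeAtDiagAdd_of

end Summit.HodgeConjecture.HodgeConjecture.Cruxes.SemiregularSheafRepresentativesTwPrimeAtDiagAdd.Birth
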